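import Summits.CriticalPhenomena.PercolationContinuityZ3.Theorems.PercNearOneGluingNoHeavyLowerTailSahiOneStepUniformThreshold
import HarnessLib

/-!
# The `(2′)` half for OPPOSITE-SHIFTED pairs at EVERY density vector (the uniform-density proof minus its compression step)

Support file (prover prim-ineq-prove-3 gen 30; `--supports stmt-CriticalPhenomena-4575`; memo
`run/shared/lean/prim/prim-ineq-prove-3/FINDING-G30-SHIFTED-PAIRS.md` §3).  No definitions, no named facts, no sorries, no `native_decide`.

In `PROOF-2PRIME-UNIFORM.md` (gen 21, kernel `osN_threshold_nonneg_of_const`) exchangeability of the density vector is used ONLY in the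
compression Lemma 3, whose role is to REACH the reduced class (`A` left-shifted, `B` right-shifted w.r.t. one ranking of the coordinates); all
the other steps — `H`-generation (`osN_ind_ind_hgen_le`), its compatibility with dominance (`dominant_hgen`, `dominated_hgen`), the cross-form step
`osN_ind_ind_nonneg_of_cross` at the lowest-ranked coordinate, MONO-A `drift_nonneg_of_dominant` (log-concavity of the layer weights) and MONO-B
`drift_nonpos_of_dominated` — hold for every density vector with entries in `(0,1)`.  Since sections of shifted events are shifted
(`section_insert_closed`, `section_sdiff_closed`), the induction closes INSIDE the reduced class, with no compression and no exchangeability: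

**`osN_threshold_nonneg_of_oppositeShifted`**: for every block `F`, every ranking `σ : ι → ℕ` injective on `F`, every density vector
`p ∈ (0,1)^F`, every `t`, and increasing `F`-determined events `A` LEFT-shifted (`ω ∈ A`, `x, y ∈ F`, `σ y < σ x`, `x ∈ ω`, `y ∉ ω` ⟹
`(ω ∖ {x}) ∪ {y} ∈ A`: lower-ranked coordinates dominate) and `B` RIGHT-shifted (`σ x < σ y` instead):  `0 ≤ n(Th_t(F); 1_A, 1_B)`, i.e.
`Cov(1_A,1_B) ≥ μ(N_F < t)·Cov(1_A,1_B ∣ N_F < t)`; hence **`sahiE3_threshold_nonneg_of_oppositeShifted`**: `0 ≤ E₃(1_{Th_t(F)}, 1_A, 1_B)`.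
(Same-direction shifted pairs: `…SahiOneStepGaleFKG` + `…SahiOneStepLayerPositive`.)
-/

noncomputable section

namespace Summit.CriticalPhenomena.PercolationContinuityZ3.Theorems

namespace SahiOneStep

open MeasureTheory Finset
open Literature.Probability.Percolation (DeterminedBy determinedBy_iff)
open Literature.Probability.LatticeModels (prodBernoulli prodBernoulli_harris sahiE3)
open Literature.Probability.Percolation.DecisionTree (ind)
open SahiE3Sections (determinedBy_section_insert determinedBy_section_sdiff)
open scoped Classical

variable {ι : Type*} [Fintype ι]

/-! ## Trades commute with sections at a third coordinate -/

omit [Fintype ι] in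
/-- `insert e ((ω − x) + y) = (insert e ω − x) + y` for `e ≠ x`. [folklore] -/
theorem insert_trade_eq {e x y : ι} (hex : e ≠ x) (ω : Set ι) :
    insert e ((ω \ {x}) ∪ {y}) = (insert e ω \ {x}) ∪ {y} := by
  ext z
  simp only [Set.mem_insert_iff, Set.mem_union, Set.mem_sdiff, Set.mem_singleton_iff]
  constructor
  · rintro (rfl | ⟨hz, hzx⟩ | rfl)
    · exact Or.inl ⟨Or.inl rfl, hex⟩
    · exact Or.inl ⟨Or.inr hz, hzx⟩
    · exact Or.inr rfl
  · rintro (⟨rfl | hz, hzx⟩ | rfl)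
    · exact Or.inl rfl
    · exact Or.inr (Or.inl ⟨hz, hzx⟩)
    · exact Or.inr (Or.inr rfl)

omit [Fintype ι] in
/-- `((ω − x) + y) − e = ((ω − e) − x) + y` for `e ≠ y`. [folklore] -/
theorem trade_sdiff_eq {e x y : ι} (hey : e ≠ y) (ω : Set ι) :
    ((ω \ {x}) ∪ {y}) \ {e} = ((ω \ {e}) \ {x}) ∪ {y} := by
  ext z
  simp only [Set.mem_union, Set.mem_sdiff, Set.mem_singleton_iff]
  constructor
  · rintro ⟨⟨hz, hzx⟩ | rfl, hze⟩
    · exact Or.inl ⟨⟨hz, hze⟩, hzx⟩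
    · exact Or.inr rfl
  · rintro (⟨⟨hz, hze⟩, hzx⟩ | rfl)
    · exact ⟨Or.inl ⟨hz, hzx⟩, hze⟩
    · exact ⟨Or.inr rfl, hey.symm⟩

omit [Fintype ι] in
/-- A trade-closure property on `F` passes to the `e`-section `{ω | insert e ω ∈ X}` (`e ∉ F`). [this work] -/
theorem section_insert_closed {F : Finset ι} {e : ι} (heF : e ∉ F) {X : Set (Set ι)} {R : ι → ι → Prop}
    (hX : ∀ ω ∈ X, ∀ x ∈ F, ∀ y ∈ F, R x y → x ∈ ω → y ∉ ω → (ω \ {x}) ∪ {y} ∈ X) :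
    ∀ ω ∈ {ω : Set ι | insert e ω ∈ X}, ∀ x ∈ F, ∀ y ∈ F, R x y → x ∈ ω → y ∉ ω → (ω \ {x}) ∪ {y} ∈ {ω : Set ι | insert e ω ∈ X} := by
  intro ω hω x hx y hy hR hxω hyω
  have hex : e ≠ x := fun h => heF (h ▸ hx)
  have hey : e ≠ y := fun h => heF (h ▸ hy)
  simp only [Set.mem_setOf_eq] at hω ⊢
  rw [insert_trade_eq hex]
  exact hX _ hω x hx y hy hR (Set.mem_insert_of_mem e hxω) (fun h => h.elim (fun h => hey h.symm) hyω)

omit [Fintype ι] in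
/-- A trade-closure property on `F` passes to the `e`-section `{ω | ω ∖ {e} ∈ X}` (`e ∉ F`). [this work] -/
theorem section_sdiff_closed {F : Finset ι} {e : ι} (heF : e ∉ F) {X : Set (Set ι)} {R : ι → ι → Prop}
    (hX : ∀ ω ∈ X, ∀ x ∈ F, ∀ y ∈ F, R x y → x ∈ ω → y ∉ ω → (ω \ {x}) ∪ {y} ∈ X) :
    ∀ ω ∈ {ω : Set ι | ω \ {e} ∈ X}, ∀ x ∈ F, ∀ y ∈ F, R x y → x ∈ ω → y ∉ ω → (ω \ {x}) ∪ {y} ∈ {ω : Set ι | ω \ {e} ∈ X} := by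
  intro ω hω x hx y hy hR hxω hyω
  have hex : e ≠ x := fun h => heF (h ▸ hx)
  have hey : e ≠ y := fun h => heF (h ▸ hy)
  simp only [Set.mem_setOf_eq] at hω ⊢
  rw [trade_sdiff_eq hey]
  exact hX _ hω x hx y hy hR ⟨hxω, fun h => hex h.symm⟩ (fun h => hyω h.1)

/-! ## The theorem -/

/-- **THE `(2′)` HALF FOR OPPOSITE-SHIFTED PAIRS, EVERY DENSITY VECTOR.**  Let `F` be a block, `σ : ι → ℕ` a ranking injective on `F`,
`p ∈ (0,1)^F`, `t : ℕ`, and `A, B` increasing events determined by `F` with `A` LEFT-shifted on `F` (for `x, y ∈ F` with `σ y < σ x`: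
`ω ∈ A`, `x ∈ ω`, `y ∉ ω` ⟹ `(ω ∖ {x}) ∪ {y} ∈ A`) and `B` RIGHT-shifted on `F` (the same with `σ x < σ y`).  Then `0 ≤ n(Th_t(F); 1_A, 1_B)`,
i.e. `Cov(1_A,1_B) ≥ μ(N_F < t)·Cov(1_A,1_B ∣ N_F < t)`. [this work] -/
theorem osN_threshold_nonneg_of_oppositeShifted (p : ι → unitInterval) (σ : ι → ℕ) (F : Finset ι) (hσ : Set.InjOn σ (↑F : Set ι))
    (hp : ∀ i ∈ F, 0 < (p i : ℝ) ∧ (p i : ℝ) < 1)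
    (t : ℕ) {A B : Set (Set ι)} (hA : IsUpperSet A) (hB : IsUpperSet B)
    (hAF : DeterminedBy A (↑F : Set ι)) (hBF : DeterminedBy B (↑F : Set ι))
    (hAs : ∀ ω ∈ A, ∀ x ∈ F, ∀ y ∈ F, σ y < σ x → x ∈ ω → y ∉ ω → (ω \ {x}) ∪ {y} ∈ A)
    (hBs : ∀ ω ∈ B, ∀ x ∈ F, ∀ y ∈ F, σ x < σ y → x ∈ ω → y ∉ ω → (ω \ {x}) ∪ {y} ∈ B) :
    0 ≤ osN p {ω : Set ι | t ≤ (F.filter (· ∈ ω)).card} (ind A) (ind B) := by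
  induction F using Finset.induction_on_min_value σ generalizing t A B with
  | empty =>
    cases t with
    | zero => rw [threshold_zero, osN_ind_ind_univ]
    | succ t => rw [threshold_empty_succ, osN_ind_ind_empty]
  | insert e F heF hmin ih =>
    have hσ' : Set.InjOn σ (↑F : Set ι) := hσ.mono (by rw [Finset.coe_insert]; exact Set.subset_insert _ _)
    have hlt : ∀ x ∈ F, σ e < σ x := by
      intro x hx
      refine lt_of_le_of_ne (hmin x hx) fun h => heF ?_
      have := hσ (by simp) (by simp [hx]) h
      rwa [this]
    have hp' : ∀ i ∈ F, 0 < (p i : ℝ) ∧ (p i : ℝ) < 1 := fun i hi => hp i (Finset.mem_insert_of_mem hi)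
    cases t with
    | zero => rw [threshold_zero, osN_ind_ind_univ]
    | succ t =>
      by_cases ht : t ≤ F.card
      swap
      · rw [threshold_eq_empty_of_card_lt (insert e F) (by rw [Finset.card_insert_of_notMem heF]; omega), osN_ind_ind_empty]
      rcases Nat.eq_zero_or_pos t with rfl | htpos
      · exact osN_thresholdOne_nonneg p (insert e F) hA hB hAF hBF
      have heG : e ∈ insert e F := Finset.mem_insert_self e F
      have hHup : IsUpperSet {ω : Set ι | t + 1 ≤ ((insert e F).filter (· ∈ ω)).card} := isUpperSet_threshold _ _
      have hHG : DeterminedBy {ω : Set ι | t + 1 ≤ ((insert e F).filter (· ∈ ω)).card} (↑(insert e F) : Set ι) :=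
        determinedBy_threshold _ _
      have hcoe : (↑(insert e F) : Set ι) \ {e} = ↑F := by
        ext i
        simp only [Set.mem_sdiff, Finset.coe_insert, Set.mem_insert_iff, Finset.mem_coe, Set.mem_singleton_iff]
        constructor
        · rintro ⟨h | h, hne⟩
          · exact absurd h hne
          · exact h
        · intro h
          exact ⟨Or.inr h, fun hie => heF (hie ▸ h)⟩
      -- the `H`-generated hulls are still shifted (`dominant_hgen` / `dominated_hgen` applied to every ranked pair)
      have hA'up := isUpperSet_hgen {ω : Set ι | t + 1 ≤ ((insert e F).filter (· ∈ ω)).card} A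
      have hB'up := isUpperSet_hgen {ω : Set ι | t + 1 ≤ ((insert e F).filter (· ∈ ω)).card} B
      have hA'G := determinedBy_hgen hHG hAF
      have hB'G := determinedBy_hgen hHG hBF
      have hA's : ∀ ω ∈ {ω : Set ι | ∀ ω' : Set ι, ω ⊆ ω' → ω' ∈ {ω : Set ι | t + 1 ≤ ((insert e F).filter (· ∈ ω)).card} → ω' ∈ A},
          ∀ x ∈ insert e F, ∀ y ∈ insert e F, σ y < σ x → x ∈ ω → y ∉ ω →
          (ω \ {x}) ∪ {y} ∈ {ω : Set ι | ∀ ω' : Set ι, ω ⊆ ω' → ω' ∈ {ω : Set ι | t + 1 ≤ ((insert e F).filter (· ∈ ω)).card} → ω' ∈ A} := by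
        intro ω hω x hx y hy hyx hxω hyω
        have hne : y ≠ x := fun h => lt_irrefl (σ x) (by rw [h] at hyx; exact hyx)
        exact dominant_hgen (G := insert e F) hy hx hne (t + 1) (A := A)
          (fun ω' hω' hyω' hxω' => hAs ω' hω' x hx y hy hyx hxω' hyω') ω hω hyω hxω
      have hB's : ∀ ω ∈ {ω : Set ι | ∀ ω' : Set ι, ω ⊆ ω' → ω' ∈ {ω : Set ι | t + 1 ≤ ((insert e F).filter (· ∈ ω)).card} → ω' ∈ B},
          ∀ x ∈ insert e F, ∀ y ∈ insert e F, σ x < σ y → x ∈ ω → y ∉ ω →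
          (ω \ {x}) ∪ {y} ∈ {ω : Set ι | ∀ ω' : Set ι, ω ⊆ ω' → ω' ∈ {ω : Set ι | t + 1 ≤ ((insert e F).filter (· ∈ ω)).card} → ω' ∈ B} := by
        intro ω hω x hx y hy hxy hxω hyω
        have hne : x ≠ y := fun h => lt_irrefl (σ x) (by rw [h] at hxy; rw [h]; exact hxy)
        exact dominated_hgen (G := insert e F) hx hy hne (t + 1) (B := B)
          (fun ω' hω' hxω' hyω' => hBs ω' hω' x hx y hy hxy hxω' hyω') ω hω hxω hyω
      refine le_trans ?_ (osN_ind_ind_hgen_le p hHup hA hB)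
      refine le_trans ?_ (osN_ind_ind_hgen_le_right p hHup hA'up hB)
      refine osN_ind_ind_nonneg_of_cross p _ _ _ e ?_ ?_ ?_ ?_ ?_ ?_ ?_ ?_
      · rw [section_insert_threshold heF]
        exact ih hσ' hp' t (isUpperSet_section_insert hA'up e) (isUpperSet_section_insert hB'up e)
          (hcoe ▸ determinedBy_section_insert hA'G e) (hcoe ▸ determinedBy_section_insert hB'G e)
          (section_insert_closed heF fun ω hω x hx y hy => hA's ω hω x (Finset.mem_insert_of_mem hx) y (Finset.mem_insert_of_mem hy))
          (section_insert_closed heF fun ω hω x hx y hy => hB's ω hω x (Finset.mem_insert_of_mem hx) y (Finset.mem_insert_of_mem hy))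
      · rw [section_sdiff_threshold heF]
        exact ih hσ' hp' (t + 1) (isUpperSet_section_sdiff hA'up e) (isUpperSet_section_sdiff hB'up e)
          (hcoe ▸ determinedBy_section_sdiff hA'G e) (hcoe ▸ determinedBy_section_sdiff hB'G e)
          (section_sdiff_closed heF fun ω hω x hx y hy => hA's ω hω x (Finset.mem_insert_of_mem hx) y (Finset.mem_insert_of_mem hy))
          (section_sdiff_closed heF fun ω hω x hx y hy => hB's ω hω x (Finset.mem_insert_of_mem hx) y (Finset.mem_insert_of_mem hy))
      · rw [section_insert_threshold heF]; exact real_threshold_lt_one p F hp' t htpos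
      · rw [section_sdiff_threshold heF]; exact real_threshold_lt_one p F hp' (t + 1) (by omega)
      · exact measureReal_mono (section_sdiff_subset_section_insert hA'up e)
      · exact measureReal_mono (section_sdiff_subset_section_insert hB'up e)
      · -- MONO-A: the lowest-ranked coordinate `e` dominates every `j ∈ F` in the left-shifted hull of `A`
        exact drift_nonneg_of_dominant p heF ht hp' hA'up hA'G
          (fun ω hω heω j hj hjω => hA's ω hω j (Finset.mem_insert_of_mem hj) e heG (hlt j hj) hjω heω)
      · -- MONO-B: `e` is dominated by every `j ∈ F` in the right-shifted, `H`-generated hull of `B`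
        exact drift_nonpos_of_dominated p heF t hB'up hB'G
          (fun ω hω heω j hj hjω => hB's ω hω e heG j (Finset.mem_insert_of_mem hj) (hlt j hj) heω hjω)
          (fun ω h ω' hsub hH' => h ω' hsub hH' ω' subset_rfl hH')

/-- **KAHN C5 / SAHI `C₃` FOR A THRESHOLD SLOT AND AN OPPOSITE-SHIFTED PAIR, EVERY DENSITY VECTOR** (`p ∈ (0,1)^F`):
`0 ≤ E₃(1_{Th_t(F)}, 1_A, 1_B)` for increasing `F`-determined `A` left-shifted and `B` right-shifted w.r.t. a ranking `σ` of `F`. [this work] -/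
theorem sahiE3_threshold_nonneg_of_oppositeShifted (p : ι → unitInterval) (σ : ι → ℕ) (F : Finset ι) (hσ : Set.InjOn σ (↑F : Set ι))
    (hp : ∀ i ∈ F, 0 < (p i : ℝ) ∧ (p i : ℝ) < 1)
    (t : ℕ) {A B : Set (Set ι)} (hA : IsUpperSet A) (hB : IsUpperSet B)
    (hAF : DeterminedBy A (↑F : Set ι)) (hBF : DeterminedBy B (↑F : Set ι))
    (hAs : ∀ ω ∈ A, ∀ x ∈ F, ∀ y ∈ F, σ y < σ x → x ∈ ω → y ∉ ω → (ω \ {x}) ∪ {y} ∈ A)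
    (hBs : ∀ ω ∈ B, ∀ x ∈ F, ∀ y ∈ F, σ x < σ y → x ∈ ω → y ∉ ω → (ω \ {x}) ∪ {y} ∈ B) :
    0 ≤ sahiE3 (prodBernoulli p) {ω : Set ι | t ≤ (F.filter (· ∈ ω)).card} A B := by
  rw [← osT_ind_ind, osT_eq_osMp_add_osN]
  exact add_nonneg (osMp_threshold_nonneg_all p F t hA hB) (osN_threshold_nonneg_of_oppositeShifted p σ F hσ hp t hA hB hAF hBF hAs hBs)

end SahiOneStep

end Summit.CriticalPhenomena.PercolationContinuityZ3.Theorems
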